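import Mathlib

/-!
# Two-spin block: exact Taylor expansion of the curve polynomial at a point, the second
# derivative along the line direction at the saddle, and the Schur-complement identity

[cite: ImbrieJSP2016, eq. (1.1), §4.2.1 (block Hamiltonians of resonant blocks)]

Companion to `TwoSpinSaddle`: with `P(x,y) = (x² − a)(y² − b) − 2t₂²(κ + xy) + t₂⁴` (`a = ρ₊²`,
`b = ρ₋²`):
* `twoSpin_curve_taylor`: the exact (terminating) Taylor expansion of the quartic `P` at `(x,y)`,
  with cubic part `2y u²v + 2x uv²` and quartic part `u²v²`;
* `twoSpin_saddle_dvv`: at the middle-gap saddle (relations `ρ₋x² = ρ₋ρ₊² − t₂²ρ₊`,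
  `ρ₊y² = ρ₊ρ₋² − t₂²ρ₋`, `xy = t₂² − ρ₊ρ₋`) the second derivative of `P` along the line direction
  `(1,1)` is `−α/…`: `ρ₊ρ₋·(∂ₓₓP + 2∂ₓᵧP + ∂ᵧᵧP) = −(8ρ₊²ρ₋² + 2t₂²(ρ₊−ρ₋)²) < 0`;
* `twoSpin_saddle_schur`: `α̃β̃ + γ̃² = 64ρ₊³ρ₋³(ρ₊ρ₋ − t₂²)` for the rescaled Hessian entries
  `α̃ = 8ρ₊²ρ₋² + 2t₂²(ρ₊−ρ₋)²`, `β̃ = 8ρ₊²ρ₋² − 2t₂²(ρ₊+ρ₋)²`, `γ̃ = 2t₂²(ρ₋² − ρ₊²)` — the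
  transverse (Schur-complement) curvature is positive exactly when the saddle is real
  (`ρ₊ρ₋ > t₂²`).
These feed the window lemma of the audit cell (pub-imbrie, LLA.md gen-6 N11): near the saddle the
middle gap obeys a two-sided `√(neck² + 4d²)` law.  Audit lemmas; they neither prove nor disprove LLA.
-/

namespace Literature.MathematicalPhysics.QuantumLattice.Imbrie2016

/-- [cite: ImbrieJSP2016, eq. (1.1), §4.2.1] Exact Taylor expansion of the curve quartic. -/
theorem twoSpin_curve_taylor (a b κ t₂ x y u v : ℝ) :
    ((x + u) ^ 2 - a) * ((y + v) ^ 2 - b) - 2 * t₂ ^ 2 * (κ + (x + u) * (y + v)) + t₂ ^ 4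
      = ((x ^ 2 - a) * (y ^ 2 - b) - 2 * t₂ ^ 2 * (κ + x * y) + t₂ ^ 4)
        + (2 * x * (y ^ 2 - b) - 2 * t₂ ^ 2 * y) * u + (2 * y * (x ^ 2 - a) - 2 * t₂ ^ 2 * x) * v
        + (1 / 2) * (2 * (y ^ 2 - b) * u ^ 2 + 2 * (4 * x * y - 2 * t₂ ^ 2) * u * v
            + 2 * (x ^ 2 - a) * v ^ 2)
        + 2 * y * u ^ 2 * v + 2 * x * u * v ^ 2 + u ^ 2 * v ^ 2 := by
  ring

/-- [cite: ImbrieJSP2016, eq. (1.1), §4.2.1] Second derivative of `P` along `(1,1)` at the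
middle-gap saddle: `ρ₊ρ₋(∂ₓₓP + 2∂ₓᵧP + ∂ᵧᵧP) = −(8ρ₊²ρ₋² + 2t₂²(ρ₊−ρ₋)²)`. -/
theorem twoSpin_saddle_dvv (ρp ρm t₂ x y : ℝ)
    (hx2 : ρm * x ^ 2 = ρm * ρp ^ 2 - t₂ ^ 2 * ρp) (hy2 : ρp * y ^ 2 = ρp * ρm ^ 2 - t₂ ^ 2 * ρm)
    (hxy : x * y = t₂ ^ 2 - ρp * ρm) :
    ρp * ρm * (2 * (y ^ 2 - ρm ^ 2) + 2 * (4 * x * y - 2 * t₂ ^ 2) + 2 * (x ^ 2 - ρp ^ 2))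
      = -(8 * ρp ^ 2 * ρm ^ 2 + 2 * t₂ ^ 2 * (ρp - ρm) ^ 2) := by
  linear_combination 2 * ρp * hx2 + 2 * ρm * hy2 + 8 * ρp * ρm * hxy

/-- [cite: ImbrieJSP2016, eq. (1.1), §4.2.1] Schur-complement identity for the rescaled saddle
Hessian: `α̃β̃ + γ̃² = 64ρ₊³ρ₋³(ρ₊ρ₋ − t₂²)`. -/
theorem twoSpin_saddle_schur (ρp ρm t₂ : ℝ) :
    (8 * ρp ^ 2 * ρm ^ 2 + 2 * t₂ ^ 2 * (ρp - ρm) ^ 2) * (8 * ρp ^ 2 * ρm ^ 2 - 2 * t₂ ^ 2 * (ρp + ρm) ^ 2)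
      + (2 * t₂ ^ 2 * (ρm ^ 2 - ρp ^ 2)) ^ 2 = 64 * ρp ^ 3 * ρm ^ 3 * (ρp * ρm - t₂ ^ 2) := by
  ring

end Literature.MathematicalPhysics.QuantumLattice.Imbrie2016
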